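import Literature.NumberTheory.Sieve.UnitLogCharacter
import Literature.Algebra.EuclideanLattices.PeriodizeComplex
import HarnessLib

/-!
# `Θ_{Ω'}(χ)` through the FIXED unit lattice `L⁺`: twisted periodization and Hecke expansion

Topic `Literature/NumberTheory/Sieve`, sub-namespace `ThetaUnits` (continued). The uniform (in the
modulus `𝔣`) form of the harmonic analysis of the smooth character sums: with `χ(u) = e(κ_χ(log u))`
on `U⁺` (`UnitLogCharacter`), the unit sum over ALL of `U⁺` is a periodization over the fixed
lattice `L⁺` of the complex bump `Φ_t · e(κ_χ ·)` (Mitsui 1956 §3; Hecke 1920 §1):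

* `Wcube_logVec_unit_mul` — `Wcube(logVec(uα)) = Φ_t(log u + h)`, `(t, h) = toTH(logVec α)`;
* `gTw χ kf M t y = Φ_t(y) e(κ_χ(y))`: smooth, supported in the ball of radius `2(log 2 − a)`;
* **`tsum_posUnits_eq_periodizeC`** —
  `∑'_{η ∈ U⁺} Ω'(ηω₀)χ(ηω₀) = χ(ω₀) e(−κ_χ(h₀)) · periodizeC L⁺ (gTw) (h₀)`;
* `coeffF χ kf M t k = covol(L⁺)⁻¹ ∫ Φ_t e(κ_χ) e_{−k}` and `XiGen χ k ω = χ(ω) e(−κ_χ(h(ω))) e_k(h(ω))`,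
  **`XiGen_unit_mul`** — `XiGen` is `U⁺`-invariant (a character of the totally positive principal
  ideals);
* **`theta_fixed_expansion`** — `Θ_{Ω'}(χ) = ∑_{𝔭 ∈ P} ∑'_k coeffF(k, t_𝔭) · XiGen_k(ω₀(𝔭))`.

## References

* T. Mitsui, Jap. J. Math. 26 (1956), §3. [cite: Mitsui1956, §3]
* E. Hecke, Math. Z. 6 (1920), §1. [cite: HeckeMathZ1920, §1]
-/

noncomputable section

open NumberField NumberField.InfinitePlace NumberField.Units NumberField.Units.dirichletUnitTheorem
  Literature.NumberTheory.LFunctions Literature.NumberTheory.LFunctions.HeckeCone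
  Literature.NumberTheory.LFunctions.AbelianDensity
  Literature.NumberTheory.Sieve.UnitKernel Literature.NumberTheory.Sieve.UnitPeriodic
  Literature.Algebra.EuclideanLattices.LatticePeriodic Module MeasureTheory
  Literature.NumberTheory.Sieve.NumberFieldLS Literature.NumberTheory.Sieve.SmoothTypeOne
  Literature.NumberTheory.Sieve.BoxPrimes Literature.NumberTheory.Sieve.TypeTwoBlock
  Literature.NumberTheory.Sieve.TypeTwoReparam Literature.NumberTheory.Sieve.SmoothSmallModuli
open scoped Classical

namespace Literature.NumberTheory.Sieve.ThetaUnits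

variable {K : Type*} [Field K] [NumberField K] [IsTotallyReal K]

local notation "RP" => {w : InfinitePlace K // IsReal w}
local notation "rkE" => finrank ℝ (logSpace K)

/-! ## The weight on `uα` in the `(t, h)` coordinates -/

omit [IsTotallyReal K] in
/-- **`W(logVec(uα)) = Φ_t(log u + h)`**, `(t, h) = toTH (logVec α)`, for a unit `u` and `α ≠ 0`.
[folklore] -/
theorem Wcube_logVec_unit_mul (kf : RP → ℝ → ℝ) (M : ℝ) (u : (𝓞 K)ˣ) {α : K} (hα : α ≠ 0) :
    Wcube K kf M (logVec K (((u : 𝓞 K) : K) * α)) =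
      PhiT K kf M (toTH K (logVec K α)).1 (logEmbedding K (Additive.ofMul u) + (toTH K (logVec K α)).2) := by
  have hu0 : ((u : 𝓞 K) : K) ≠ 0 := by exact_mod_cast u.ne_zero
  unfold PhiT
  rw [logVec_mul hu0 hα, ← ofTH_toTH (logVec K ((u : 𝓞 K) : K) + logVec K α), toTH_add, toTH_logVec_unit,
    show ((0 : ℝ), logEmbedding K (Additive.ofMul u)) + toTH K (logVec K α) =
      ((toTH K (logVec K α)).1, logEmbedding K (Additive.ofMul u) + (toTH K (logVec K α)).2) from Prod.ext (zero_add _) rfl]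

/-! ## The twisted bump -/

variable {𝔣 : Ideal (𝓞 K)} (χ : AddChar (Additive ((𝓞 K ⧸ 𝔣)ˣ)) ℂ)

/-- `gTw(y) = Φ_t(y) e(κ_χ(y))`. [cite: Mitsui1956, §3] -/
def gTw (kf : RP → ℝ → ℝ) (M t : ℝ) (y : logSpace K) : ℂ := (PhiT K kf M t y : ℂ) * eC (kappa χ y)

/-- `gTw` is smooth for smooth profiles. [folklore] -/
theorem contDiff_gTw {kf : RP → ℝ → ℝ} (hk : ∀ w, ContDiff ℝ (⊤ : ℕ∞) (kf w)) (M t : ℝ) :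
    ContDiff ℝ (⊤ : ℕ∞) (gTw χ kf M t) := by
  unfold gTw eC
  refine (Complex.ofRealCLM.contDiff.comp (contDiff_PhiT kf hk M t)).mul ?_
  refine Complex.contDiff_exp.comp ?_
  exact contDiff_const.mul (Complex.ofRealCLM.contDiff.comp (kappa χ).contDiff)

/-- Support of `gTw`: the ball of radius `2(log 2 − a)`. [folklore] -/
theorem gTw_eq_zero_of_norm_gt {kf : RP → ℝ → ℝ} {a : ℝ} (hlo : ∀ w v, v < a - Real.log 2 → kf w v = 0)
    (hhi : ∀ w v, 0 < v → kf w v = 0) (M t : ℝ) {y : logSpace K} (hy : 2 * (Real.log 2 - a) < ‖y‖) :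
    gTw χ kf M t y = 0 := by
  unfold gTw
  rw [PhiT_eq_zero_of_norm_gt hlo hhi M t hy]
  simp

/-! ## The unit sum as a twisted periodization over `L⁺` -/

/-- `L⁺ ≃ U⁺`, `ℓ ↦ uOf ℓ`. [folklore] -/
def latEquiv : posUnitLattice K ≃ posUnits K := Multiplicative.ofAdd.trans (logEquiv K).symm.toEquiv

/-- The value of `latEquiv`. [folklore] -/
theorem latEquiv_apply (ℓ : posUnitLattice K) : latEquiv (K := K) ℓ = uOf K ℓ := rfl

/-- **The unit sum as a twisted periodization**: for `ω₀ ≠ 0`, `M > 0`, `𝔣 ≠ 0` and profiles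
vanishing off `[a − log 2, 0]`,
`∑'_{η ∈ U⁺} Ω'(ηω₀)χ(ηω₀) = χ(ω₀) e(−κ_χ(h₀)) · periodizeC L⁺ gTw (h₀)`,
`(t₀, h₀) = toTH(logVec ω₀)`. [cite: Mitsui1956, §3] -/
theorem tsum_posUnits_eq_periodizeC [Finite (𝓞 K ⧸ 𝔣)] {kf : RP → ℝ → ℝ} {a : ℝ}
    (hlo : ∀ w v, v < a - Real.log 2 → kf w v = 0) (hhi : ∀ w v, 0 < v → kf w v = 0) (M : ℝ)
    {ω₀ : 𝓞 K} (hω₀ : ω₀ ≠ 0) :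
    ∑' η : posUnits K, Fsum χ kf M ω₀ η =
      unitValue χ (Ideal.Quotient.mk 𝔣 ω₀) * eC (-(kappa χ (toTH K (logVec K (ω₀ : K))).2)) *
        periodizeC (posUnitLattice K) (gTw χ kf M (toTH K (logVec K (ω₀ : K))).1) (toTH K (logVec K (ω₀ : K))).2 := by
  have hω₀K : ((ω₀ : 𝓞 K) : K) ≠ 0 := by exact_mod_cast hω₀
  rw [periodizeC_eq_tsum (fun y hy => gTw_eq_zero_of_norm_gt χ hlo hhi M _ hy), ← tsum_mul_left,
    ← (latEquiv (K := K)).tsum_eq]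
  refine tsum_congr fun ℓ => ?_
  rw [latEquiv_apply]
  unfold Fsum gTw
  rw [weightΩfam_eq_Wcube', unitValue_unit_mul χ, unitChar_uOf χ ℓ]
  push_cast
  rw [Wcube_logVec_unit_mul kf M _ hω₀K, logEmbedding_uOf, map_add, eC_add]
  -- `e(-κ h₀) e(κ ℓ) e(κ h₀) = e(κ ℓ)`
  have hcancel : eC (-(kappa χ (toTH K (logVec K (ω₀ : K))).2)) * eC (kappa χ (toTH K (logVec K (ω₀ : K))).2) = 1 := by
    rw [← eC_add, neg_add_cancel]; simp [eC]
  rw [add_comm ((ℓ : posUnitLattice K) : logSpace K)]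
  linear_combination (PhiT K kf M (toTH K (logVec K (ω₀ : K))).1
    ((toTH K (logVec K (ω₀ : K))).2 + (ℓ : logSpace K)) : ℂ) * eC (kappa χ (ℓ : logSpace K)) *
      unitValue χ (Ideal.Quotient.mk 𝔣 ω₀) * (-1 : ℂ) * hcancel

/-! ## The coefficients and the characters of the fixed-lattice expansion -/

/-- `ĉ(k, t) = covol(L⁺)⁻¹ ∫ Φ_t(y) e(κ_χ(y)) e_{−k}(y) dy`. [cite: HeckeMathZ1920, §1] -/
def coeffF (kf : RP → ℝ → ℝ) (M t : ℝ) (k : Fin rkE → ℤ) : ℂ :=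
  ((volume : Measure (logSpace K)).real (fdom (posUnitLattice K)))⁻¹ *
    ∫ y, gTw χ kf M t y * echar (posUnitLattice K) (-k) y

/-- The trace-zero log coordinate `h(ω)` of an integer. [folklore] -/
abbrev hCoord (ω : 𝓞 K) : logSpace K := (toTH K (logVec K (ω : K))).2

/-- `Ξ_k(ω) = χ(ω) e(−κ_χ(h(ω))) e_k(h(ω))`: the value at a generator of the `k`-th twisted
character. [cite: HeckeMathZ1920, §1] -/
def XiGen (k : Fin rkE → ℤ) (ω : 𝓞 K) : ℂ :=
  unitValue χ (Ideal.Quotient.mk 𝔣 ω) * eC (-(kappa χ (hCoord ω))) * echar (posUnitLattice K) k (hCoord ω)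

/-- **`Ξ_k` is `U⁺`-invariant**: `Ξ_k(uω) = Ξ_k(ω)` for a totally positive unit `u` and `ω ≠ 0`
(`𝔣 ≠ 0`) — `Ξ_k` is a character of the totally positive principal ideals. [cite: HeckeMathZ1920, §1] -/
theorem XiGen_unit_mul [Finite (𝓞 K ⧸ 𝔣)] (k : Fin rkE → ℤ) (u : posUnits K) {ω : 𝓞 K} (hω : ω ≠ 0) :
    XiGen χ k ((((u : posUnits K) : (𝓞 K)ˣ) : 𝓞 K) * ω) = XiGen χ k ω := by
  have hh : hCoord ((((u : posUnits K) : (𝓞 K)ˣ) : 𝓞 K) * ω) =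
      logEmbedding K (Additive.ofMul ((u : posUnits K) : (𝓞 K)ˣ)) + hCoord ω := by
    unfold hCoord
    rw [toTH_logVec_unit_mul _ hω]
  unfold XiGen
  rw [hh, unitValue_unit_mul χ, map_add, neg_add, eC_add, echar_add,
    echar_of_mem (posUnitLattice K) k (logEmbedding_mem_posUnitLattice u.2), unitChar_eq_eC_kappa χ u]
  have hcancel : eC (kappa χ (logEmbedding K (Additive.ofMul ((u : posUnits K) : (𝓞 K)ˣ)))) *
      eC (-(kappa χ (logEmbedding K (Additive.ofMul ((u : posUnits K) : (𝓞 K)ˣ))))) = 1 := by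
    rw [← eC_add, add_neg_cancel]; simp [eC]
  linear_combination unitValue χ (Ideal.Quotient.mk 𝔣 ω) * eC (-(kappa χ (hCoord ω))) *
    echar (posUnitLattice K) k (hCoord ω) * hcancel

/-- **The expansion of one ideal term**: for `ω₀ ≠ 0`,
`∑'_{η ∈ U⁺} Ω'(ηω₀)χ(ηω₀) = ∑'_k ĉ(k, t₀) Ξ_k(ω₀)` as a `HasSum`. [cite: Mitsui1956, §3] -/
theorem hasSum_ideal_term [Finite (𝓞 K ⧸ 𝔣)] {kf : RP → ℝ → ℝ} (hk : ∀ w, ContDiff ℝ (⊤ : ℕ∞) (kf w)) {a : ℝ}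
    (hlo : ∀ w v, v < a - Real.log 2 → kf w v = 0) (hhi : ∀ w v, 0 < v → kf w v = 0) (M : ℝ)
    {ω₀ : 𝓞 K} (hω₀ : ω₀ ≠ 0) :
    HasSum (fun k : Fin rkE → ℤ => coeffF χ kf M (toTH K (logVec K (ω₀ : K))).1 k * XiGen χ k ω₀)
      (∑' η : posUnits K, Fsum χ kf M ω₀ η) := by
  rw [tsum_posUnits_eq_periodizeC χ hlo hhi M hω₀]
  have hexp := hasSum_echar_periodizeC (L := posUnitLattice K) (volume : Measure (logSpace K))
    (contDiff_gTw χ hk M (toTH K (logVec K (ω₀ : K))).1)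
    (fun y hy => gTw_eq_zero_of_norm_gt χ hlo hhi M (toTH K (logVec K (ω₀ : K))).1 hy)
    (toTH K (logVec K (ω₀ : K))).2
  have hexp2 := hexp.mul_left (unitValue χ (Ideal.Quotient.mk 𝔣 ω₀) * eC (-(kappa χ (toTH K (logVec K (ω₀ : K))).2)))
  refine hexp2.congr_fun fun k => ?_ |> fun h' => h'
  unfold coeffF XiGen hCoord
  ring

/-- **The fixed-lattice Hecke expansion of `Θ_{Ω'}(χ)`**:
`Θ = ∑_{𝔭 ∈ P} ∑'_k ĉ(k, t_𝔭) Ξ_k(ω₀(𝔭))`, each series convergent (`M > 0`, `𝔣 ≠ 0`, smooth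
profiles supported in `[a − log 2, 0]`). [cite: Mitsui1956, §3] -/
theorem theta_fixed_expansion [Finite (𝓞 K ⧸ 𝔣)] {kf : RP → ℝ → ℝ} (hk : ∀ w, ContDiff ℝ (⊤ : ℕ∞) (kf w)) {a : ℝ}
    (hlo : ∀ w v, v < a - Real.log 2 → kf w v = 0) (hhi : ∀ w v, 0 < v → kf w v = 0) {M : ℝ} (hM : 0 < M) :
    theta K kf M χ = ∑ 𝔭 ∈ Pset (K := K) M, ∑' k : Fin rkE → ℤ,
      coeffF χ kf M (toTH K (logVec K (gen M 𝔭 : K))).1 k * XiGen χ k (gen M 𝔭) := by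
  rw [theta_eq_sum_ideals χ hhi hM]
  refine Finset.sum_congr rfl fun 𝔭 h𝔭 => ?_
  have h0 : gen M 𝔭 ≠ 0 := (Finset.mem_filter.1 (gen_spec h𝔭).1).2.ne_zero
  exact ((hasSum_ideal_term χ hk hlo hhi M h0).tsum_eq).symm

/-- Summability of the expansion of one ideal term. [folklore] -/
theorem summable_ideal_term [Finite (𝓞 K ⧸ 𝔣)] {kf : RP → ℝ → ℝ} (hk : ∀ w, ContDiff ℝ (⊤ : ℕ∞) (kf w)) {a : ℝ}
    (hlo : ∀ w v, v < a - Real.log 2 → kf w v = 0) (hhi : ∀ w v, 0 < v → kf w v = 0) (M : ℝ)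
    {ω₀ : 𝓞 K} (hω₀ : ω₀ ≠ 0) :
    Summable fun k : Fin rkE → ℤ => coeffF χ kf M (toTH K (logVec K (ω₀ : K))).1 k * XiGen χ k ω₀ :=
  (hasSum_ideal_term χ hk hlo hhi M hω₀).summable

end Literature.NumberTheory.Sieve.ThetaUnits
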